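import Summits.AtomisticToContinuum.Crystallization.Theses.ChessboardParticlePlanes

/-!
# Crux `ChessboardParticlePlanes.LjPlaneChessboard` (stmt-AtomisticToContinuum-6709), line `Sketch`,
# stub `motifSum_transversal` — a lattice-invariant function summed over two transversals

Let `Q` be a periodic configuration of `ℝ³` with lattice of periods `G = Q.lattice`, motif
`F = Q.motif` and point set `S = F + G = Q.points`, and let `d : ℝ³ → ℝ` be `G`-invariant on `S`
(`d (x + g) = d x` for `x ∈ S`, `g ∈ G`).  If the finite set `T ⊂ S` is a second transversal of
`S` modulo `G` (its points are pairwise inequivalent modulo `G`, and every point of `S` is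
congruent modulo `G` to one of them), then `Σ_{x ∈ F} d x = Σ_{t ∈ T} d t`.  [folklore]

PROOF.  The motif `F` is itself a transversal of `S` modulo `G` (`Q.eq_of_sub_mem`,
`Q.exists_sub_mem_lattice`).  The map `φ : F → T` sending `m` to the (unique) `t ∈ T` with
`m − t ∈ G` and the map `ψ : T → F` sending `t` to the (unique) `m ∈ F` with `t − m ∈ G` are
mutually inverse: `m − ψ (φ m) = (m − φ m) + (φ m − ψ (φ m)) ∈ G` forces `ψ (φ m) = m`
(inequivalence of `F`), and symmetrically `φ (ψ t) = t` (inequivalence of `T`); and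
`d m = d (φ m + (m − φ m)) = d (φ m)` by invariance at `φ m ∈ S`.  Conclude with
`Finset.sum_bij'`.  No definition is introduced; the file depends only on the route file.
-/

noncomputable section

namespace Summit.AtomisticToContinuum.Crystallization.Theorems.ChessboardParticlePlanesLjPlaneChessboard

open Literature.MathematicalPhysics.StatisticalMechanics

/-- **A lattice-invariant function has the same sum over any two transversals.**  For a periodic
configuration `Q` of `ℝ³` (point set `S = F + G`), a function `d` with `d (x + g) = d x` for
`x ∈ S`, `g ∈ G`, and a finite transversal `T ⊂ S` of `S` modulo `G` (pairwise inequivalent,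
meeting every class), `Σ_{x ∈ F} d x = Σ_{t ∈ T} d t`: the class map `F → T`, `m ↦ t` with
`m − t ∈ G`, is a bijection (inverse: the motif representative, `exists_sub_mem_lattice`;
inequivalence of `F` by `Q.eq_of_sub_mem`, of `T` by hypothesis) along which `d` is constant.
[folklore] -/
theorem motifSum_transversal :
    ∀ (Q : PeriodicConfiguration 3) (d : EuclideanSpace ℝ (Fin 3) → ℝ)
      (T : Finset (EuclideanSpace ℝ (Fin 3))),
      (∀ x ∈ Q.points, ∀ g ∈ Q.lattice, d (x + g) = d x) →
      (∀ t ∈ T, t ∈ Q.points) → (∀ t ∈ T, ∀ t' ∈ T, t - t' ∈ Q.lattice → t = t') →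
      (∀ y ∈ Q.points, ∃ t ∈ T, y - t ∈ Q.lattice) →
      ∑ x ∈ Q.motif, d x = ∑ t ∈ T, d t := by
  intro Q d T hd hT hTs hTc
  -- `φ m hm ∈ T`: the representative in `T` of the class of the motif point `m`
  choose φ hφ hφm using fun m (hm : m ∈ Q.motif) => hTc m (Q.mem_points_of_mem_motif hm)
  -- `ψ t ht ∈ F`: the motif representative of the class of `t ∈ T`
  choose ψ hψ hψm using fun t (ht : t ∈ T) => Q.exists_sub_mem_lattice (hT t ht)
  refine Finset.sum_bij' φ ψ hφ hψ (fun m hm => ?_) (fun t ht => ?_) (fun m hm => ?_)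
  · -- `ψ (φ m) = m`: both are motif points and `m - ψ (φ m) ∈ G`
    refine Q.eq_of_sub_mem _ (hψ _ _) m hm ?_
    have h1 := Q.lattice.add_mem (hφm m hm) (hψm (φ m hm) (hφ m hm))
    rw [sub_add_sub_cancel] at h1
    exact sub_mem_comm_iff.1 h1
  · -- `φ (ψ t) = t`: both lie in `T` and `t - φ (ψ t) ∈ G`
    refine hTs _ (hφ _ _) t ht ?_
    have h1 := Q.lattice.add_mem (hψm t ht) (hφm (ψ t ht) (hψ t ht))
    rw [sub_add_sub_cancel] at h1
    exact sub_mem_comm_iff.1 h1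
  · -- `d m = d (φ m)`: `m = φ m + (m - φ m)` with `φ m ∈ S` and `m - φ m ∈ G`
    have h1 := hd (φ m hm) (hT _ (hφ m hm)) (m - φ m hm) (hφm m hm)
    rwa [add_sub_cancel] at h1

end Summit.AtomisticToContinuum.Crystallization.Theorems.ChessboardParticlePlanesLjPlaneChessboard

end
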